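import Summits.QuantumFields.GaugeBoot.Certificates.N1c2D3Tab
import Summits.QuantumFields.GaugeBoot.Rows.GLYZc2D3Ent
import HarnessLib

/-!
# Bridge: lean1's `GLYZc2D3.redBlock` interface ↔ the family tables `N1c2D3` (gb_lean_emit_reduced 0.8)

HONEST FRAMING (cell `pub-gaugeboot`): certified bounds on lattice expectations at stated coupling,
gauge group, dimension and torus size; NOT a mass gap, NOT a continuum limit, NOT a string tension;
NOT Yang–Mills-summit-bearing (barriers `FixedCouplingUltralocality`, `PerturbativeInvisibility`).

the 24 glyz-c2-rp-3D certificate halves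
(CERTIFIED rows C32–C33, C51–C60; lead A150 (4)) take `hpsd : ∀ k : Fin 18, (GLYZc2D3.redBlock k y).PosSemidef` over lean1's
`Rows/GLYZc2D3Ent.lean` (packed table `GLYZc2D3.ent`, p262238).  The certificate kernel checks
(position lists, cover, traces; `Certificates/SparseReduced*.lean`) run over the list tables
`N1c2D3.EB` (`Certificates/N1c2D3EntA/B/C.lean`, an independent transcription of the same 24 problem
files).  This module checks IN THE KERNEL that the two transcriptions agree on every entry of every
block (`bridge_chk`: for all `k < 18`, `bdim k = dimL[k]` and for all `i, j < bdim k`,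
`GLYZc2D3.ent k i j = Sparse.ent EB k i j` as lists), identifies lean1's evaluation `SVec.eval (yN y)`
with `Sparse.evalComb`, and transfers positive semidefiniteness:
`redE_posSemidef_of_redBlock : (GLYZc2D3.redBlock k y).PosSemidef → (Sparse.redE EB k (dimL[k]) 1449 y).PosSemidef`
(the reduced block used by `Sparse.objective_bound_red`).  Nothing is claimed about lattice gauge
theory in this file.
-/

namespace Summit.QuantumFields.GaugeBoot.Certificates.N1c2D3

noncomputable section

open Matrix Summit.QuantumFields.GaugeBoot.Certificates.Sparse
open Summit.QuantumFields.GaugeBoot (GLYZc2D3.bdim GLYZc2D3.ent GLYZc2D3.yN GLYZc2D3.redBlock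
  GLYZc2D3.SVec.eval)

/-- Boolean agreement check of the two transcriptions: dimensions, and every in-range entry of
every block as a list of (variable, coefficient) pairs. -/
def bridgeChk : Bool :=
  (List.finRange 18).all fun k =>
    (GLYZc2D3.bdim k == dimL.getD k.val 0) &&
      natAll (GLYZc2D3.bdim k) fun i => natAll (GLYZc2D3.bdim k) fun j =>
        GLYZc2D3.ent k i j == Sparse.ent EB k.val i j

set_option maxHeartbeats 0 in
/-- Kernel check: lean1's packed table and the list tables agree (18 blocks, 6528 in-range entries). -/
theorem bridge_chk : bridgeChk = true := by
  decide +kernel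

/-- The block dimensions agree. -/
theorem bdim_eq (k : Fin 18) : GLYZc2D3.bdim k = dimL.getD k.val 0 := by
  have h := List.all_eq_true.mp bridge_chk k (List.mem_finRange k)
  simp only [Bool.and_eq_true, beq_iff_eq] at h
  exact h.1

/-- The entries agree in range. -/
theorem ent_eq (k : Fin 18) {i j : ℕ} (hi : i < GLYZc2D3.bdim k) (hj : j < GLYZc2D3.bdim k) :
    GLYZc2D3.ent k i j = Sparse.ent EB k.val i j := by
  have h := List.all_eq_true.mp bridge_chk k (List.mem_finRange k)
  simp only [Bool.and_eq_true, beq_iff_eq] at h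
  have h2 := natAll_iff.mp (natAll_iff.mp h.2 i hi) j hj
  exact beq_iff_eq.mp h2

/-- lean1's evaluation of a sparse form at `yN y` is `Sparse.evalComb`. -/
theorem eval_yN_eq_evalComb (y : Fin 1449 → ℝ) :
    ∀ L : List (ℕ × ℤ), GLYZc2D3.SVec.eval (GLYZc2D3.yN y) L = Sparse.evalComb L y
  | [] => by simp
  | (v, c) :: rest => by
      rw [GLYZc2D3.SVec.eval_cons, evalComb_cons, eval_yN_eq_evalComb y rest]
      congr 1
      by_cases hv : v < 1449
      · rw [dif_pos hv]; simp [GLYZc2D3.yN, hv]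
      · rw [dif_neg hv]; simp [GLYZc2D3.yN, hv]

/-- The certificate-side reduced block is lean1's `redBlock`, re-indexed along `dimL[k] = bdim k`. -/
theorem redE_eq_submatrix (k : Fin 18) (y : Fin 1449 → ℝ) :
    Sparse.redE EB k.val (dimL.getD k.val 0) 1449 y =
      (GLYZc2D3.redBlock k y).submatrix (Fin.cast (bdim_eq k).symm) (Fin.cast (bdim_eq k).symm) := by
  ext i j
  have hi : i.val < GLYZc2D3.bdim k := (bdim_eq k).symm ▸ i.isLt
  have hj : j.val < GLYZc2D3.bdim k := (bdim_eq k).symm ▸ j.isLt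
  rw [redE_apply, Matrix.submatrix_apply, GLYZc2D3.redBlock, Matrix.of_apply, Fin.val_cast,
    Fin.val_cast, ent_eq k hi hj, eval_yN_eq_evalComb]

/-- **PSD transfer**: lean1's reduced block `k` PSD ⇒ the certificate-side reduced block `k` PSD. -/
theorem redE_posSemidef_of_redBlock (k : Fin 18) (y : Fin 1449 → ℝ)
    (h : (GLYZc2D3.redBlock k y).PosSemidef) :
    (Sparse.redE EB k.val (dimL.getD k.val 0) 1449 y).PosSemidef := by
  rw [redE_eq_submatrix]; exact h.submatrix _

/-- **Hypothesis adapter for the landed certificate modules** (`N1c2D3b<tag>{Up,Lo}.var_.._of_feasible`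
take `hpsd : ∀ k, (N1c2D3.redBlock k y).PosSemidef`): lean1's `GLYZc2D3.redBlock_posSemidef` gives the
premise of this lemma, its conclusion is that `hpsd` (interface A of record, lead A150 (4)). -/
theorem hpsd_of_GLYZ (y : Fin 1449 → ℝ) (h : ∀ k : Fin 18, (GLYZc2D3.redBlock k y).PosSemidef) :
    ∀ k : Fin 18, (redBlock k y).PosSemidef :=
  fun k => by rw [redBlock_eq]; exact redE_posSemidef_of_redBlock k y (h k)

end

end Summit.QuantumFields.GaugeBoot.Certificates.N1c2D3
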